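import Literature.MathematicalPhysics.QuantumFieldTheory.QCDOS
import HarnessLib

/-!
# The physical-branch (ray) certificate of a lattice QCD regularisation

Definition request `defn-QCDRegularisation.OnPhysicalBranch` (route `QuarkMassMonotone` of the
sub-problem `QCD` of `QuantumFields`; its items `LatticeGapMonotone`, `AnchoredQCDTwo`,
`AnchoredQCDThree` inline the term verbatim — `QCDRegularisation.onPhysicalBranch_iff` below is
that term, by `Iff.rfl`, so a later restate is definitional). Vocabulary: `QCDRegularisation`,
`QCDRegularisation.scheme`, `QCDLatticeObservable`, `qcdLatticeConnectedCorr` of `QCDOS.lean`.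

Contents:
* `QCDUniformClustering β mq δ` — volume-uniform exponential clustering, at lattice rate `δ`, of
  the connected Euclidean-time correlations of ALL pairs of gauge-invariant local lattice QCD
  observables at inverse bare coupling `β` (tree normalisation `β = 2/g₀²`) and bare Wilson masses
  `mq`, on all large tori `2S+1`, separations `n ≤ S` ("the bare point `(β, mq)` is in the massive
  phase"; the fixed-coupling kernel of `QCDScheme.HasLatticeMassGap`).
* `QCDRegularisation.OnPhysicalBranch reg m` — eventually in `k`: for every `t ≥ 0` the bare tuple
  `m_f(k) + t`, `m_f(k) = m_crit(k) + a_k m_f / Z_m(k)` the trajectory of `reg.scheme m`, is in the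
  massive phase of `β_k` at some rate `δ = δ(k,t) > 0` — the closed bare ray above `m`'s tuple.
* API (all proved): `QCDUniformClustering.mono` (a smaller rate is still a rate),
  `QCDRegularisation.onPhysicalBranch_iff` (the inlined term), `OnPhysicalBranch.add_const`
  (upward closure along the ray: `m ↦ m + c`, `c ≥ 0` flavour-blind),
  `OnPhysicalBranch.eventually_clustering` (`t = 0`: the scheme's own bare masses are eventually
  in the massive phase).

Why a ray, and why `∀ᶠ k, ∀ t ≥ 0, ∃ δ` (the planner's degenerate-case check recorded in the route
thesis, not re-derived here): monotonicity of lattice masses in the bare Wilson mass is only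
expected on the physical branch — below the last doubler (`m₀ < −8`, i.e. hopping parameter
`κ ∈ (−1/8, 0)`) and between the critical lines of the doublers there are free lattice masses that
decrease as `m₀` grows (free `D†D(p) = (m₀ + Σ_μ(1 − cos p_μ))² + Σ_μ sin² p_μ`), and a bare ray from
such a point to `+∞` crosses the flavour–parity broken (Aoki) phase or a first-order line, where
volume-uniform clustering at a positive rate fails (massless pions inside the Aoki phase:
Aoki 1984; Sharpe–Singleton 1998 §4; catalogued barrier
`Literature.Barriers.QuantumFields.AokiPhaseDichotomy`). Putting `∀ t` inside `∀ᶠ k` (rather than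
`∀ t, ∀ᶠ k`) makes the certificate uniform along the ray at each large `k`, so that no family
`t_k → ∞` slips through.

NOT here: any claim that an honest regularisation satisfies the certificate (that is the content
of the route's anchored items), the transfer-matrix / spectral reading of clustering (exponential
decay of connected correlators at the rate of the gap, Montvay–Münster §1.5.2 (1.199)–(1.201); a
`qcdTransferGap` is a separate request), rates in physical units (`QCDScheme.HasLatticeMassGap`).
-/

open Filter Topology

namespace Literature.MathematicalPhysics.QuantumFieldTheory

variable {Nf : ℕ}

/-- **Volume-uniform exponential clustering of lattice QCD at the bare point `(β, m_q)` with
lattice rate `δ`** ("`(β, m_q)` is in the massive phase"): for every pair `A, B` of gauge-invariant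
local lattice QCD observables (any quark boxes `R, R'`) there are `C` and `S₀` such that on every
torus of side `2S+1`, `S ≥ S₀`, at inverse bare coupling `β` (tree normalisation `β = 2/g₀²`) and
bare Wilson masses `m_q`, for all Euclidean-time separations `n ≤ S`,
`‖⟨A · τ_{n e₀}B⟩_S − ⟨A⟩_S⟨B⟩_S‖ ≤ C e^{−δ n}` (`qcdLatticeConnectedCorr`; rate in lattice units,
constants uniform in the volume, no constraint linking `C` to `A, B`). On a transfer-matrix
lattice theory exponential decay of all connected correlations at rate `δ` is the Euclidean face
of a gap `≥ δ` above the vacuum (Montvay–Münster (1.199)–(1.201): `⟨φφ⟩_c ∝ e^{−(E₁−E₀)|x₁−x₂|}`,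
`ξ = (E₁ − E₀)⁻¹`); here it is only DEFINED, as the fixed-coupling, fixed-mass kernel of
`QCDScheme.HasLatticeMassGap` (there: along a scheme, rate `Δ a_k`, tori `S ≥ L_k`).
[cite: MontvayMunster1994, §1.5.2 (1.199)–(1.201)] [cite: OsterwalderSeiler1978, §§2–4] -/
def QCDUniformClustering (β : ℝ) (mq : Fin Nf → ℝ) (δ : ℝ) : Prop :=
  ∀ (R R' : ℕ) (A : QCDLatticeObservable Nf R) (B : QCDLatticeObservable Nf R'),
    ∃ (C : ℝ) (S₀ : ℕ), ∀ S : ℕ, S₀ ≤ S → ∀ n : ℕ, n ≤ S →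
      ‖qcdLatticeConnectedCorr β (2 * S + 1) mq A B n‖ ≤ C * Real.exp (-(δ * n))

/-- **Rate monotonicity**: clustering at rate `δ` implies clustering at every rate `δ' ≤ δ`
(replace `C` by `max C 0`). [folklore] -/
theorem QCDUniformClustering.mono {β : ℝ} {mq : Fin Nf → ℝ} {δ δ' : ℝ}
    (h : QCDUniformClustering β mq δ) (hδ' : δ' ≤ δ) : QCDUniformClustering β mq δ' := by
  intro R R' A B
  obtain ⟨C, S₀, hC⟩ := h R R' A B
  refine ⟨max C 0, S₀, fun S hS n hn => (hC S hS n hn).trans ?_⟩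
  have h1 : Real.exp (-(δ * n)) ≤ Real.exp (-(δ' * n)) :=
    Real.exp_le_exp.mpr (neg_le_neg (mul_le_mul_of_nonneg_right hδ' (Nat.cast_nonneg n)))
  calc C * Real.exp (-(δ * n)) ≤ max C 0 * Real.exp (-(δ * n)) :=
        mul_le_mul_of_nonneg_right (le_max_left _ _) (Real.exp_pos _).le
    _ ≤ max C 0 * Real.exp (-(δ' * n)) := mul_le_mul_of_nonneg_left h1 (le_max_right _ _)

namespace QCDRegularisation

/-- **The physical-branch (ray) certificate of the regularisation `reg` at the renormalised mass
tuple `m`**: eventually in `k`, for EVERY `t ≥ 0` there is a lattice rate `δ > 0` at which lattice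
QCD at the regularisation's inverse bare coupling `β_k` and at the bare Wilson masses
`m_f(k) + t`, `m_f(k) = m_crit(k) + a_k m_f / Z_m(k)` (the trajectory `(reg.scheme m _ _).mq`,
which does not read the species renormalisations — taken `0, 0`), clusters volume-uniformly
(`QCDUniformClustering`): every bare tuple on the closed flavour-blind ray above `m`'s bare tuple is
in the massive phase of `β_k`. The hypothesis under which route `QuarkMassMonotone` transports a
uniform lattice gap up the quark-mass axis; it is upward closed along the ray by construction
(`OnPhysicalBranch.add_const`) and deliberately says nothing below the tuple or off the diagonal
direction (route thesis: on the doubler branches of Wilson fermions there are lattice masses that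
decrease with the bare mass, and a bare ray to `+∞` from there crosses the flavour–parity broken
(Aoki) phase, inside which two pions are massless, so clustering at a positive rate fails).
[cite: SharpeSingleton1998, §4] [cite: Aoki1984WilsonPhase] -/
def OnPhysicalBranch (reg : QCDRegularisation Nf) (m : Fin Nf → ℝ) : Prop :=
  ∀ᶠ k in atTop, ∀ t : ℝ, 0 ≤ t → ∃ δ : ℝ, 0 < δ ∧
    QCDUniformClustering (reg.β k) (fun f => (reg.scheme m 0 0).mq f k + t) δ

/-- **Unfolding to the term inlined in route `QuarkMassMonotone`** (items `LatticeGapMonotone`,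
`AnchoredQCDTwo`, `AnchoredQCDThree`): definitional (`Iff.rfl`), so restating those items over
`reg.OnPhysicalBranch m` does not change their meaning. [folklore] -/
theorem onPhysicalBranch_iff (reg : QCDRegularisation Nf) (m : Fin Nf → ℝ) :
    reg.OnPhysicalBranch m ↔
      ∀ᶠ k in Filter.atTop, ∀ t : ℝ, 0 ≤ t → ∃ δ : ℝ, 0 < δ ∧
        ∀ (R R' : ℕ) (A : QCDLatticeObservable Nf R) (B : QCDLatticeObservable Nf R'),
          ∃ (C : ℝ) (S₀ : ℕ), ∀ S : ℕ, S₀ ≤ S → ∀ n : ℕ, n ≤ S →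
            ‖qcdLatticeConnectedCorr (reg.β k) (2 * S + 1)
                (fun f => (reg.scheme m 0 0).mq f k + t) A B n‖ ≤ C * Real.exp (-(δ * n)) :=
  Iff.rfl

/-- The bare trajectory of the flavour-blind shifted tuple `m + c` is the trajectory of `m`
shifted by `a_k c / Z_m(k)` (ring identity in `QCDRegularisation.scheme_mq`). [folklore] -/
theorem scheme_mq_add_const (reg : QCDRegularisation Nf) (m : Fin Nf → ℝ) (c : ℝ)
    (z shift : QCDField Nf → ℕ → ℝ) (f : Fin Nf) (k : ℕ) :
    (reg.scheme (fun g => m g + c) z shift).mq f k =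
      (reg.scheme m z shift).mq f k + reg.a k * c / reg.Zm k := by
  simp only [scheme_mq]
  ring

/-- **Upward closure along the ray**: if the certificate holds at `m`, it holds at every
flavour-blind shift `m + c`, `c ≥ 0` — the ray above `(m + c)`'s bare tuple is the sub-ray
`t ≥ a_k c / Z_m(k) ≥ 0` of the ray above `m`'s (uses `a_k > 0`, `Z_m(k) > 0`). [folklore] -/
theorem OnPhysicalBranch.add_const {reg : QCDRegularisation Nf} {m : Fin Nf → ℝ}
    (h : reg.OnPhysicalBranch m) {c : ℝ} (hc : 0 ≤ c) :
    reg.OnPhysicalBranch (fun f => m f + c) := by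
  filter_upwards [h] with k hk t ht
  have hs : 0 ≤ reg.a k * c / reg.Zm k :=
    div_nonneg (mul_nonneg (reg.a_pos k).le hc) (reg.Zm_pos k).le
  obtain ⟨δ, hδ, hcl⟩ := hk (reg.a k * c / reg.Zm k + t) (add_nonneg hs ht)
  refine ⟨δ, hδ, ?_⟩
  have hfun : (fun f => (reg.scheme (fun g => m g + c) 0 0).mq f k + t) =
      fun f => (reg.scheme m 0 0).mq f k + (reg.a k * c / reg.Zm k + t) := by
    funext f
    rw [scheme_mq_add_const]
    ring
  rw [hfun]
  exact hcl

/-- **At `t = 0`**: on the physical branch the scheme's OWN bare masses are eventually in the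
massive phase of `β_k` (some lattice rate `δ_k > 0`; nothing is said about `δ_k a_k⁻¹`). [folklore] -/
theorem OnPhysicalBranch.eventually_clustering {reg : QCDRegularisation Nf} {m : Fin Nf → ℝ}
    (h : reg.OnPhysicalBranch m) :
    ∀ᶠ k in atTop, ∃ δ : ℝ, 0 < δ ∧
      QCDUniformClustering (reg.β k) (fun f => (reg.scheme m 0 0).mq f k) δ := by
  filter_upwards [h] with k hk
  simpa using hk 0 le_rfl

/-- The certificate reads only `a, β, m_crit, Z_m` of the regularisation and the tuple `m`: the
bare trajectory fed to it is that of `reg.scheme m z shift` for ANY species renormalisations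
`z, shift`. [folklore] -/
theorem OnPhysicalBranch.clustering_scheme {reg : QCDRegularisation Nf} {m : Fin Nf → ℝ}
    (h : reg.OnPhysicalBranch m) (z shift : QCDField Nf → ℕ → ℝ) :
    ∀ᶠ k in atTop, ∀ t : ℝ, 0 ≤ t → ∃ δ : ℝ, 0 < δ ∧
      QCDUniformClustering (reg.β k) (fun f => (reg.scheme m z shift).mq f k + t) δ :=
  h

end QCDRegularisation

end Literature.MathematicalPhysics.QuantumFieldTheory
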